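import Literature.NumberTheory.LFunctions.ZetaFractionalPartIntegral
import Literature.NumberTheory.LFunctions.ZetaLogDerivDisc
import Literature.NumberTheory.LFunctions.MertensElementary
import Mathlib.NumberTheory.AbelSummation
import Mathlib.NumberTheory.LSeries.Nonvanishing
import Mathlib.NumberTheory.LSeries.DirichletContinuation
import Mathlib.Analysis.Complex.Liouville
import Mathlib.NumberTheory.Harmonic.ZetaAsymp
import Mathlib.NumberTheory.Harmonic.Bounds
import HarnessLib

/-!
# `ζ(s)`, `ζ'(s)`, `1/ζ(s)` and `ζ'/ζ(s)` near the line `σ = 1` (Titchmarsh §§3.5–3.6)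

Topic `Literature/NumberTheory/LFunctions` (trunk T-ANT). Everything in this file is PROVED (no
named facts, no `sorry`): the classical elementary bounds of Titchmarsh, *The Theory of the
Riemann Zeta-Function*, 2nd ed. (1986), Theorem 3.5 and §3.6, with explicit (unoptimised) absolute
constants, in the form consumed by the tree's proof of the prime number theorem with error
`O(x (log x)^{-A})` (`ChebyshevPsiLogPowerError.lean`, discharging the `π`- versus `ψ`-form
equivalence `Literature.NumberTheory.Sieve.primesHaveLevel_iff_primesHaveLevelPi`).

* `riemannZeta_eq_sum_add_sub_integral` — (3.5.3) with an integer break-point: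
  `ζ(s) = ∑_{n ≤ N} n^{-s} + N^{1-s}/(s-1) - s ∫_N^∞ {x} x^{-s-1} dx` (`Re s > 0`, `s ≠ 1`), from
  the tree's Titchmarsh (2.1.4) (`Literature.NumberTheory.LFunctions.riemannZeta_eq_of_re_pos`) and Mathlib's Abel summation.
* `norm_riemannZeta_le_log` — **Thm. 3.5** (3.5.1): `‖ζ(σ+it)‖ ≤ 21 log|t|` for `|t| ≥ 3`,
  `σ ≥ 1 - 1/(2 log|t|)`.
* `norm_deriv_riemannZeta_le_log_sq` — (3.5.5): `‖ζ'(σ+it)‖ ≤ 336 log²|t|` for `|t| ≥ 4`,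
  `σ ≥ 1 - 1/(8 log|t|)` (Cauchy's estimate on a disc of radius `1/(8 log|t|)`).
* `one_le_norm_riemannZeta_three_four_one`, `norm_riemannZeta_pow_four_ge` — (3.6.1)
  (`ζ³(σ)|ζ(σ+it)|⁴|ζ(σ+2it)| ≥ 1`, Mathlib `DirichletCharacter.norm_LFunction_product_ge_one`).
* `norm_riemannZeta_sub_horizontal_le` — (3.6.2).
* `norm_riemannZeta_ge_inv_log_pow_seven` — (3.6.3)–(3.6.5): with `K = 1134·16·336⁴`,
  `‖ζ(σ+it)‖ ≥ 168/(K log⁷|t|)` for `|t| ≥ 4`, `1 - 1/(2K log⁹|t|) ≤ σ ≤ 2`; hence the zero-free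
  region `σ ≥ 1 - 1/(2K log⁹|t|)` (`riemannZeta₁_ne_zero_of_re_ge`).
* `norm_logDeriv_riemannZeta₁_le` — (3.6.6) for the entire function `ζ₁(s) = (s-1)ζ(s)` (Mathlib
  `riemannZeta₁`), whose logarithmic derivative `ζ₁'/ζ₁ = 1/(s-1) + ζ'/ζ` has no pole at `s = 1`:
  `‖ζ₁'/ζ₁(σ+it)‖ ≤ 3K log⁹|t|` in the same region.

## Design notes

* Regions are phrased with `|t| = |Im s|` and explicit numerical thresholds/constants instead of
  "`t > t₀`, some `A`"; every constant printed by Titchmarsh as `A` is made explicit (any admissible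
  value would do; nothing is optimised).  Only `σ ≤ 2` is covered in §3.6-type lower bounds (for
  `σ ≥ 2` one has trivially `|ζ| ≥ 2 - π²/6`), which is all the applications need.
* Namespace `Literature.ZetaOneLine` (to keep the short Mathlib-style names from colliding with the tree).
  Small inputs reused from the tree: `Literature.NumberTheory.LFunctions.riemannZeta₁_eq_mul` (`ZetaLogDerivDisc.lean`),
  `Literature.NumberTheory.LFunctions.MertensBound.one_lt_log_three` (`MertensElementary.lean`).

## References

* E. C. Titchmarsh, *The Theory of the Riemann Zeta-Function*, 2nd ed. (rev. D. R. Heath-Brown),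
  Oxford 1986, §3.5 (Thm. 3.5, (3.5.1)–(3.5.5)), §3.6 ((3.6.1)–(3.6.7)).
* H. L. Montgomery, R. C. Vaughan, *Multiplicative Number Theory I*, CUP 2007, Thm. 1.12 (the
  `{x}`-form of (3.5.3)), §6.1.
-/

noncomputable section

open Complex Filter Topology Set MeasureTheory Asymptotics

namespace Literature.NumberTheory.LFunctions.ZetaOneLine

/-- The tail fractional-part integral splits at an integer `N ≥ 1`:
`∫_1^∞ {x} x^{-(s+1)} dx = ∫_1^N {x} x^{-(s+1)} dx + ∫_N^∞ {x} x^{-(s+1)} dx` (`Re s > 0`). [folklore] -/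
theorem fractIntegral_eq_add {s : ℂ} (hs : 0 < s.re) {N : ℕ} (hN : 1 ≤ N) :
    Literature.NumberTheory.LFunctions.fractIntegral s =
      (∫ x in Ioc (1 : ℝ) N, ((Int.fract x : ℝ) : ℂ) * (x : ℂ) ^ (-(s + 1))) +
        ∫ x in Ioi (N : ℝ), ((Int.fract x : ℝ) : ℂ) * (x : ℂ) ^ (-(s + 1)) := by
  have hN' : (1 : ℝ) ≤ N := by exact_mod_cast hN
  have hint := Literature.NumberTheory.LFunctions.integrableOn_fract_mul_cpow hs
  rw [Literature.NumberTheory.LFunctions.fractIntegral_def, ← Ioc_union_Ioi_eq_Ioi hN',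
    setIntegral_union (Ioc_disjoint_Ioi le_rfl) measurableSet_Ioi
      (hint.mono_set (Ioc_subset_Ioi_self)) (hint.mono_set (Ioi_subset_Ioi hN'))]

/-- Abel summation for `∑_{1 < k ≤ N} k^{-s}` (`s ≠ 0`):
`∑_{k=2}^{N} k^{-s} = N^{1-s} - 1 + s ∫_1^N ⌊t⌋ t^{-(s+1)} dt`. [folklore] -/
theorem sum_Ioc_cpow_neg_eq {s : ℂ} (hs : s ≠ 0) (N : ℕ) (hN : 1 ≤ N) :
    ∑ k ∈ Finset.Ioc 1 N, (k : ℂ) ^ (-s) =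
      (N : ℂ) ^ (1 - s) - 1 + s * ∫ t in Ioc (1 : ℝ) N, ((⌊t⌋₊ : ℕ) : ℂ) * (t : ℂ) ^ (-(s + 1)) := by
  -- Abel summation with `c k = [k ≠ 0]`, `f t = t^{-s}`
  set c : ℕ → ℂ := fun k => if k = 0 then 0 else 1 with hc
  set f : ℝ → ℂ := fun t => (t : ℂ) ^ (-s) with hf
  have hcsum : ∀ m : ℕ, ∑ k ∈ Finset.Icc 0 m, c k = m := by
    intro m
    rw [Finset.sum_ite, Finset.sum_const_zero, zero_add, Finset.sum_const, nsmul_eq_mul, mul_one]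
    have : (Finset.filter (fun k => ¬k = 0) (Finset.Icc 0 m)) = Finset.Icc 1 m := by
      ext k; simp only [Finset.mem_filter, Finset.mem_Icc]; omega
    rw [this, Nat.card_Icc]; simp
  have hderiv : ∀ t : ℝ, 0 < t → HasDerivAt f (-s * (t : ℂ) ^ (-s - 1)) t := by
    intro t ht
    have := hasDerivAt_ofReal_cpow_const (r := -s) ht.ne' (neg_ne_zero.mpr hs)
    simpa [hf] using this
  have hf_diff : ∀ t ∈ Icc (1 : ℝ) N, DifferentiableAt ℝ f t := fun t ht =>
    (hderiv t (zero_lt_one.trans_le ht.1)).differentiableAt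
  have hderiv_eq : EqOn (deriv f) (fun t : ℝ => -s * (t : ℂ) ^ (-s - 1)) (Icc (1 : ℝ) N) :=
    fun t ht => (hderiv t (zero_lt_one.trans_le ht.1)).deriv
  have hcont : ContinuousOn (fun t : ℝ => -s * (t : ℂ) ^ (-s - 1)) (Icc (1 : ℝ) N) := by
    refine continuousOn_const.mul (ContinuousOn.cpow_const ?_ ?_)
    · exact continuous_ofReal.continuousOn
    · intro t ht
      exact Or.inl (by simpa using zero_lt_one.trans_le ht.1)
  have hf_int : IntegrableOn (deriv f) (Icc (1 : ℝ) N) :=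
    (hcont.integrableOn_Icc).congr_fun hderiv_eq.symm measurableSet_Icc
  have hf_diff' : ∀ t ∈ Icc ((1 : ℕ) : ℝ) N, DifferentiableAt ℝ f t := by
    rw [Nat.cast_one]; exact hf_diff
  have hf_int' : IntegrableOn (deriv f) (Icc ((1 : ℕ) : ℝ) N) := by
    rw [Nat.cast_one]; exact hf_int
  have habel := sum_mul_eq_sub_sub_integral_mul' c hN hf_diff' hf_int'
  rw [Nat.cast_one] at habel
  -- simplify the left side
  have hlhs : ∑ k ∈ Finset.Ioc 1 N, f k * c k = ∑ k ∈ Finset.Ioc 1 N, (k : ℂ) ^ (-s) := by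
    refine Finset.sum_congr rfl fun k hk => ?_
    have hk0 : k ≠ 0 := by rw [Finset.mem_Ioc] at hk; omega
    simp [hf, hc, hk0]
  rw [hlhs] at habel
  rw [habel, hcsum, hcsum]
  -- the integral: replace `deriv f` and the partial sums
  have hIcongr : EqOn (fun t : ℝ => deriv f t * ∑ k ∈ Finset.Icc 0 ⌊t⌋₊, c k)
      (fun t : ℝ => -s * (((⌊t⌋₊ : ℕ) : ℂ) * (t : ℂ) ^ (-(s + 1)))) (Ioc (1 : ℝ) N) := by
    intro t ht
    simp only
    rw [hcsum, hderiv_eq ⟨ht.1.le, ht.2⟩]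
    rw [show -s - 1 = -(s + 1) by ring]
    ring
  rw [setIntegral_congr_fun measurableSet_Ioc hIcongr, integral_const_mul]
  have hN0 : (N : ℂ) ≠ 0 := Nat.cast_ne_zero.mpr (by omega)
  have hfN : f N = (N : ℂ) ^ (-s) := by simp [hf]
  have hf1 : f 1 = 1 := by simp [hf]
  rw [hfN, hf1]
  rw [show (N : ℂ) ^ (1 - s) = (N : ℂ) ^ (-s) * N by
    rw [sub_eq_add_neg, add_comm, cpow_add _ _ hN0, cpow_one]]
  push_cast
  ring

/-- **The approximate formula for `ζ(s)` by a partial sum** (Titchmarsh (3.5.3), the case of an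
integer break-point, in the `{x}`-normalisation of Montgomery–Vaughan Thm. 1.12): for `Re s > 0`,
`s ≠ 1` and every integer `N ≥ 1`,
`ζ(s) = ∑_{n ≤ N} n^{-s} + N^{1-s}/(s-1) - s ∫_N^∞ {x} x^{-(s+1)} dx`.
Proof: Titchmarsh (2.1.4) `ζ(s) = s/(s-1) - s∫_1^∞ {x}x^{-s-1} dx` (tree,
`Literature.NumberTheory.LFunctions.riemannZeta_eq_of_re_pos`) and Abel summation on `[1, N]`.
[cite: Titchmarsh1986, §3.5 eq. (3.5.3)] -/
theorem riemannZeta_eq_sum_add_sub_integral {s : ℂ} (hs : 0 < s.re) (hs1 : s ≠ 1) {N : ℕ}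
    (hN : 1 ≤ N) :
    riemannZeta s = ∑ n ∈ Finset.Icc 1 N, (n : ℂ) ^ (-s) + (N : ℂ) ^ (1 - s) / (s - 1) -
      s * ∫ x in Ioi (N : ℝ), ((Int.fract x : ℝ) : ℂ) * (x : ℂ) ^ (-(s + 1)) := by
  have hs0 : s ≠ 0 := by rintro rfl; simp at hs
  have hs1' : s - 1 ≠ 0 := sub_ne_zero.mpr hs1
  have hs1'' : 1 - s ≠ 0 := sub_ne_zero.mpr (Ne.symm hs1)
  have hN' : (1 : ℝ) ≤ N := by exact_mod_cast hN
  -- the three integrals over `(1, N]`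
  set g : ℝ → ℂ := fun x => (x : ℂ) ^ (-s) with hg
  set h : ℝ → ℂ := fun x => ((⌊x⌋₊ : ℕ) : ℂ) * (x : ℂ) ^ (-(s + 1)) with hh
  set j : ℝ → ℂ := fun x => ((Int.fract x : ℝ) : ℂ) * (x : ℂ) ^ (-(s + 1)) with hj
  have hI_g : ∫ x in Ioc (1 : ℝ) N, g x = ((N : ℂ) ^ (1 - s) - 1) / (1 - s) := by
    rw [← intervalIntegral.integral_of_le hN', hg]
    have hcond : -1 < (-s).re ∨ -s ≠ -1 ∧ (0 : ℝ) ∉ Set.uIcc (1 : ℝ) N := by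
      refine Or.inr ⟨by rwa [Ne, neg_inj], ?_⟩
      rw [Set.uIcc_of_le hN']
      intro h0
      exact absurd h0.1 (by norm_num)
    rw [integral_cpow hcond]
    simp only [ofReal_natCast, ofReal_one, one_cpow]
    rw [show -s + 1 = 1 - s by ring]
  have hI_h : s * ∫ x in Ioc (1 : ℝ) N, h x =
      ∑ k ∈ Finset.Ioc 1 N, (k : ℂ) ^ (-s) - (N : ℂ) ^ (1 - s) + 1 := by
    rw [sum_Ioc_cpow_neg_eq hs0 N hN, hh]
    ring
  have hint_j : IntegrableOn j (Ioc (1 : ℝ) N) :=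
    (Literature.NumberTheory.LFunctions.integrableOn_fract_mul_cpow hs).mono_set Ioc_subset_Ioi_self
  have hint_g : IntegrableOn g (Ioc (1 : ℝ) N) := by
    refine (ContinuousOn.integrableOn_Icc ?_).mono_set Ioc_subset_Icc_self
    refine ContinuousOn.cpow_const continuous_ofReal.continuousOn ?_
    intro t ht
    exact Or.inl (by simpa using zero_lt_one.trans_le ht.1)
  -- pointwise: `⌊x⌋ x^{-(s+1)} = x^{-s} - {x} x^{-(s+1)}` on `(1, N]`
  have hpt : EqOn h (fun x => g x - j x) (Ioc (1 : ℝ) N) := by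
    intro t ht
    have ht0 : 0 < t := zero_lt_one.trans ht.1
    have hfl : ((⌊t⌋₊ : ℕ) : ℂ) = (t : ℂ) - ((Int.fract t : ℝ) : ℂ) := by
      have h1 : ((⌊t⌋₊ : ℕ) : ℝ) = (⌊t⌋ : ℝ) := natCast_floor_eq_intCast_floor ht0.le
      have h2 : (Int.fract t : ℝ) = t - ⌊t⌋ := rfl
      have : ((⌊t⌋₊ : ℕ) : ℝ) = t - Int.fract t := by rw [h1, h2]; ring
      exact_mod_cast congrArg (fun r : ℝ => (r : ℂ)) this
    have hpow : (t : ℂ) ^ (-s) = (t : ℂ) * (t : ℂ) ^ (-(s + 1)) := by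
      have ht' : (t : ℂ) ≠ 0 := ofReal_ne_zero.mpr ht0.ne'
      rw [show -s = 1 + (-(s + 1)) by ring, cpow_add _ _ ht', cpow_one]
    simp only [hh, hg, hj]
    rw [hfl, hpow]
    ring
  have hI_hgj : ∫ x in Ioc (1 : ℝ) N, h x =
      (∫ x in Ioc (1 : ℝ) N, g x) - ∫ x in Ioc (1 : ℝ) N, j x := by
    rw [setIntegral_congr_fun measurableSet_Ioc hpt, integral_sub hint_g hint_j]
  -- assemble
  rw [Literature.NumberTheory.LFunctions.riemannZeta_eq_of_re_pos hs hs1, fractIntegral_eq_add hs hN]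
  have hsum : ∑ n ∈ Finset.Icc 1 N, (n : ℂ) ^ (-s) = 1 + ∑ k ∈ Finset.Ioc 1 N, (k : ℂ) ^ (-s) := by
    rw [Finset.Icc_eq_cons_Ioc hN, Finset.sum_cons]
    simp
  have hJ : ∫ x in Ioc (1 : ℝ) N, j x =
      ((N : ℂ) ^ (1 - s) - 1) / (1 - s) -
        (∑ k ∈ Finset.Ioc 1 N, (k : ℂ) ^ (-s) - (N : ℂ) ^ (1 - s) + 1) / s := by
    rw [← hI_h, ← hI_g, mul_div_cancel_left₀ _ hs0, hI_hgj]
    ring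
  change s / (s - 1) - s * ((∫ x in Ioc (1 : ℝ) N, j x) + ∫ x in Ioi (N : ℝ), j x) =
    ∑ n ∈ Finset.Icc 1 N, (n : ℂ) ^ (-s) + (N : ℂ) ^ (1 - s) / (s - 1) -
      s * ∫ x in Ioi (N : ℝ), j x
  rw [hJ, hsum]
  field_simp
  ring

/-! ## Titchmarsh's Theorem 3.5: `ζ(s) = O(log t)` near `σ = 1` -/

/-- Tail bound: `‖∫_c^∞ {x} x^{-(s+1)} dx‖ ≤ c^{-σ}/σ` for `c ≥ 1`, `σ = Re s > 0`. [folklore] -/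
theorem norm_integral_Ioi_fract_mul_cpow_le {s : ℂ} (hs : 0 < s.re) {c : ℝ} (hc : 1 ≤ c) :
    ‖∫ x in Ioi c, ((Int.fract x : ℝ) : ℂ) * (x : ℂ) ^ (-(s + 1))‖ ≤ c ^ (-s.re) / s.re := by
  have hc0 : 0 < c := zero_lt_one.trans_le hc
  have hint : IntegrableOn (fun x : ℝ ↦ x ^ (-(s.re + 1))) (Ioi c) :=
    integrableOn_Ioi_rpow_of_lt (by linarith) hc0
  have hval : ∫ x in Ioi c, x ^ (-(s.re + 1)) = c ^ (-s.re) / s.re := by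
    rw [integral_Ioi_rpow_of_lt (by linarith) hc0]
    rw [show -(s.re + 1) + 1 = -s.re by ring]
    field_simp
  rw [← hval]
  refine norm_integral_le_of_norm_le hint ?_
  rw [ae_restrict_iff' measurableSet_Ioi]
  refine Eventually.of_forall fun x (hx : c < x) ↦ ?_
  have := Literature.NumberTheory.LFunctions.norm_fract_mul_cpow_le (hc0.trans hx) (-(s + 1))
  simpa using this

/-- In Titchmarsh's region `σ ≥ 1 - 1/(2 log|t|)`, `|t| ≥ 3`: for `1 ≤ y ≤ |t|`, `y^{1-σ} ≤ 3`
(indeed `≤ e^{1/2}`). [cite: Titchmarsh1986, §3.5 proof of Thm. 3.5] -/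
theorem rpow_one_sub_le_three {y t σ : ℝ} (hy : 1 ≤ y) (hyt : y ≤ |t|) (ht : 3 ≤ |t|)
    (hσ : 1 - 1 / (2 * Real.log |t|) ≤ σ) : y ^ (1 - σ) ≤ 3 := by
  have hL : 1 < Real.log |t| := MertensBound.one_lt_log_three.trans_le (Real.log_le_log (by norm_num) ht)
  have hy0 : 0 < y := zero_lt_one.trans_le hy
  have hlogy : 0 ≤ Real.log y := Real.log_nonneg hy
  have hlogy' : Real.log y ≤ Real.log |t| := Real.log_le_log hy0 hyt
  rw [Real.rpow_def_of_pos hy0]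
  have hexp : Real.log y * (1 - σ) ≤ 1 := by
    by_cases h1 : 1 - σ ≤ 0
    · nlinarith
    · push Not at h1
      have h2 : 1 - σ ≤ 1 / (2 * Real.log |t|) := by linarith
      calc Real.log y * (1 - σ) ≤ Real.log |t| * (1 / (2 * Real.log |t|)) := by
            gcongr
        _ = 1 / 2 := by field_simp
        _ ≤ 1 := by norm_num
  calc Real.exp (Real.log y * (1 - σ)) ≤ Real.exp 1 := Real.exp_le_exp.mpr hexp
    _ ≤ 3 := by have := Real.exp_one_lt_d9; linarith

/-- **Titchmarsh's Theorem 3.5** (`ζ(s) = O(log t)` uniformly for `1 - A/log t ≤ σ`, here with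
`A = 1/2` and an explicit constant): for `|t| ≥ 3` and `σ ≥ 1 - 1/(2 log|t|)`,
`‖ζ(σ + it)‖ ≤ 21 log|t|`. Proof as in Titchmarsh: the approximate formula (3.5.3) with
`N = ⌊|t|⌋`, `|n^{-s}| ≤ e^{1/2}/n` for `n ≤ N`, and trivial bounds for the two remaining terms.
[cite: Titchmarsh1986, Thm. 3.5 (3.5.1)–(3.5.2)] -/
theorem norm_riemannZeta_le_log {s : ℂ} (ht : 3 ≤ |s.im|)
    (hσ : 1 - 1 / (2 * Real.log |s.im|) ≤ s.re) :
    ‖riemannZeta s‖ ≤ 21 * Real.log |s.im| := by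
  set t := s.im with htdef
  set σ := s.re with hσdef
  have hL : 1 < Real.log |t| := MertensBound.one_lt_log_three.trans_le (Real.log_le_log (by norm_num) ht)
  have hL0 : 0 < Real.log |t| := zero_lt_one.trans hL
  have hσhalf : 1 / 2 ≤ σ := by
    have : 1 / (2 * Real.log |t|) ≤ 1 / 2 := by
      rw [div_le_div_iff₀ (by positivity) (by norm_num)]
      linarith
    linarith
  have hσ0 : 0 < σ := by linarith
  have hs1 : s ≠ 1 := by
    intro h
    have : t = 0 := by rw [htdef, h]; simp
    rw [this, abs_zero] at ht
    linarith
  -- `N = ⌊|t|⌋`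
  set N : ℕ := ⌊|t|⌋₊ with hNdef
  have hN3 : 3 ≤ N := Nat.le_floor (by simpa using ht)
  have hN1 : 1 ≤ N := le_trans (by norm_num) hN3
  have hNt : (N : ℝ) ≤ |t| := Nat.floor_le (abs_nonneg t)
  have hNt' : |t| / 2 ≤ N := by
    have := Nat.lt_floor_add_one |t|
    rw [← hNdef] at this
    linarith
  have hN0 : (0 : ℝ) < N := by exact_mod_cast (lt_of_lt_of_le (by norm_num) hN3)
  have hformula := riemannZeta_eq_sum_add_sub_integral (by simpa using hσ0) hs1 hN1
  -- (a) the partial sum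
  have ha : ‖∑ n ∈ Finset.Icc 1 N, (n : ℂ) ^ (-s)‖ ≤ 6 * Real.log |t| := by
    have h1 : ‖∑ n ∈ Finset.Icc 1 N, (n : ℂ) ^ (-s)‖ ≤ ∑ n ∈ Finset.Icc 1 N, 3 * (n : ℝ)⁻¹ := by
      refine (norm_sum_le _ _).trans (Finset.sum_le_sum fun n hn ↦ ?_)
      rw [Finset.mem_Icc] at hn
      have hn0 : 0 < n := hn.1
      have hnR : (1 : ℝ) ≤ n := by exact_mod_cast hn.1
      have hnt : (n : ℝ) ≤ |t| := le_trans (by exact_mod_cast hn.2) hNt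
      rw [norm_natCast_cpow_of_pos hn0, neg_re, ← hσdef]
      have : (n : ℝ) ^ (-σ) = (n : ℝ) ^ (1 - σ) * (n : ℝ)⁻¹ := by
        rw [← Real.rpow_neg_one, ← Real.rpow_add (by positivity)]
        ring_nf
      rw [this]
      gcongr
      exact rpow_one_sub_le_three hnR hnt ht hσ
    have h2 : ∑ n ∈ Finset.Icc 1 N, (n : ℝ)⁻¹ ≤ 1 + Real.log N := by
      have := harmonic_le_one_add_log N
      simpa [harmonic_eq_sum_Icc] using this
    have h3 : Real.log N ≤ Real.log |t| := Real.log_le_log hN0 hNt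
    calc ‖∑ n ∈ Finset.Icc 1 N, (n : ℂ) ^ (-s)‖ ≤ ∑ n ∈ Finset.Icc 1 N, 3 * (n : ℝ)⁻¹ := h1
      _ = 3 * ∑ n ∈ Finset.Icc 1 N, (n : ℝ)⁻¹ := by rw [Finset.mul_sum]
      _ ≤ 3 * (1 + Real.log N) := by gcongr
      _ ≤ 6 * Real.log |t| := by linarith
  -- (b) the term `N^{1-s}/(s-1)`
  have hb : ‖(N : ℂ) ^ (1 - s) / (s - 1)‖ ≤ 1 := by
    rw [norm_div, norm_natCast_cpow_of_pos (by omega), sub_re, one_re, ← hσdef]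
    have hs1norm : |t| ≤ ‖s - 1‖ := by
      have := abs_im_le_norm (s - 1)
      simpa [← htdef] using this
    have h3 : (N : ℝ) ^ (1 - σ) ≤ 3 := rpow_one_sub_le_three (by exact_mod_cast hN1) hNt ht hσ
    rw [div_le_one (lt_of_lt_of_le (by linarith) hs1norm)]
    linarith
  -- (c) the tail integral
  have hc : ‖s * ∫ x in Ioi (N : ℝ), ((Int.fract x : ℝ) : ℂ) * (x : ℂ) ^ (-(s + 1))‖ ≤ 14 := by
    rw [norm_mul]
    have h1 := norm_integral_Ioi_fract_mul_cpow_le (s := s) (by simpa using hσ0)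
      (show (1 : ℝ) ≤ N by exact_mod_cast hN1)
    rw [← hσdef] at h1
    have hsn : ‖s‖ ≤ σ + |t| := by
      have := Complex.norm_le_abs_re_add_abs_im s
      rwa [← hσdef, ← htdef, abs_of_pos hσ0] at this
    have hNσ : (N : ℝ) ^ (-σ) ≤ 6 / |t| := by
      have : (N : ℝ) ^ (-σ) = (N : ℝ) ^ (1 - σ) * (N : ℝ)⁻¹ := by
        rw [← Real.rpow_neg_one, ← Real.rpow_add hN0]
        ring_nf
      rw [this]
      have h3 : (N : ℝ) ^ (1 - σ) ≤ 3 := rpow_one_sub_le_three (by exact_mod_cast hN1) hNt ht hσ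
      have h4 : (N : ℝ)⁻¹ ≤ 2 / |t| := by
        rw [inv_eq_one_div, div_le_div_iff₀ hN0 (by linarith)]
        linarith
      calc (N : ℝ) ^ (1 - σ) * (N : ℝ)⁻¹ ≤ 3 * (2 / |t|) := by
            gcongr
        _ = 6 / |t| := by ring
    have ht0 : 0 < |t| := by linarith
    calc ‖s‖ * ‖∫ x in Ioi (N : ℝ), ((Int.fract x : ℝ) : ℂ) * (x : ℂ) ^ (-(s + 1))‖
        ≤ (σ + |t|) * ((N : ℝ) ^ (-σ) / σ) := by gcongr
      _ ≤ (σ + |t|) * ((6 / |t|) / σ) := by gcongr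
      _ = 6 / |t| + 6 / σ := by field_simp
      _ ≤ 6 / 3 + 6 / (1 / 2) := by gcongr
      _ = 14 := by norm_num
  rw [hformula]
  calc ‖∑ n ∈ Finset.Icc 1 N, (n : ℂ) ^ (-s) + (N : ℂ) ^ (1 - s) / (s - 1) -
        s * ∫ x in Ioi (N : ℝ), ((Int.fract x : ℝ) : ℂ) * (x : ℂ) ^ (-(s + 1))‖
      ≤ ‖∑ n ∈ Finset.Icc 1 N, (n : ℂ) ^ (-s)‖ + ‖(N : ℂ) ^ (1 - s) / (s - 1)‖ +
        ‖s * ∫ x in Ioi (N : ℝ), ((Int.fract x : ℝ) : ℂ) * (x : ℂ) ^ (-(s + 1))‖ :=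
        (norm_sub_le _ _).trans (by gcongr; exact norm_add_le _ _)
    _ ≤ 6 * Real.log |t| + 1 + 14 := by gcongr
    _ ≤ 21 * Real.log |t| := by nlinarith

/-! ## `ζ'(s) = O(log² t)` (Titchmarsh (3.5.5)) by Cauchy's estimate -/

/-- `log(|t| + 1) ≤ 2 log|t|` for `|t| ≥ 2`. [folklore] -/
theorem log_abs_add_one_le {t : ℝ} (ht : 2 ≤ |t|) : Real.log (|t| + 1) ≤ 2 * Real.log |t| := by
  have h : |t| + 1 ≤ |t| ^ 2 := by nlinarith
  calc Real.log (|t| + 1) ≤ Real.log (|t| ^ 2) := Real.log_le_log (by positivity) h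
    _ = 2 * Real.log |t| := by rw [Real.log_pow]; norm_num

/-- `ζ` is complex differentiable at every point with non-zero imaginary part. [folklore] -/
theorem differentiableAt_riemannZeta_of_im_ne_zero {z : ℂ} (hz : z.im ≠ 0) :
    DifferentiableAt ℂ riemannZeta z :=
  differentiableAt_riemannZeta fun h => hz (by rw [h]; simp)

/-- **Titchmarsh (3.5.5)**: `ζ'(s) = O(log² t)` in the region of Theorem 3.5; explicitly, for
`|t| ≥ 4` and `σ ≥ 1 - 1/(8 log|t|)`, `‖ζ'(σ+it)‖ ≤ 336 (log|t|)²`. Titchmarsh differentiates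
(3.5.3); here, equivalently, Cauchy's estimate on the disc of radius `1/(8 log|t|)`, which lies in
the region of `norm_riemannZeta_le_log`. [cite: Titchmarsh1986, §3.5 eq. (3.5.5)] -/
theorem norm_deriv_riemannZeta_le_log_sq {s : ℂ} (ht : 4 ≤ |s.im|)
    (hσ : 1 - 1 / (8 * Real.log |s.im|) ≤ s.re) :
    ‖deriv riemannZeta s‖ ≤ 336 * Real.log |s.im| ^ 2 := by
  set t := s.im with htdef
  set L := Real.log |t| with hLdef
  have hL : 1 < L :=
    MertensBound.one_lt_log_three.trans_le (Real.log_le_log (by norm_num) (le_trans (by norm_num) ht))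
  have hL0 : 0 < L := zero_lt_one.trans hL
  set r := 1 / (8 * L) with hrdef
  have hr0 : 0 < r := by positivity
  have hr8 : r ≤ 1 / 8 := by
    rw [hrdef, div_le_div_iff₀ (by positivity) (by norm_num)]
    linarith
  -- points of the closed disc are in the region of Theorem 3.5, at height comparable to `t`
  have hdisc : ∀ z ∈ Metric.closedBall s r, 3 ≤ |z.im| ∧ Real.log |z.im| ≤ 2 * L ∧
      1 - 1 / (2 * Real.log |z.im|) ≤ z.re := by
    intro z hz
    rw [Metric.mem_closedBall, dist_eq_norm] at hz
    have him : |z.im - t| ≤ r := by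
      have := abs_im_le_norm (z - s); simpa [← htdef] using this.trans hz
    have hre : |z.re - s.re| ≤ r := by
      have := abs_re_le_norm (z - s); simpa using this.trans hz
    have h1 : |t| - r ≤ |z.im| := by
      have := abs_sub_abs_le_abs_sub t z.im
      rw [abs_sub_comm] at him
      linarith
    have h2 : |z.im| ≤ |t| + r := by
      have := abs_sub_abs_le_abs_sub z.im t
      linarith
    have hz3 : 3 ≤ |z.im| := by linarith
    have hzlog : Real.log |z.im| ≤ 2 * L := by
      calc Real.log |z.im| ≤ Real.log (|t| + 1) :=
            Real.log_le_log (by linarith) (by linarith)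
        _ ≤ 2 * L := log_abs_add_one_le (le_trans (by norm_num) ht)
    have hzlog0 : 0 < Real.log |z.im| :=
      lt_trans zero_lt_one (MertensBound.one_lt_log_three.trans_le (Real.log_le_log (by norm_num) hz3))
    refine ⟨hz3, hzlog, ?_⟩
    have h3 : 1 / (4 * L) ≤ 1 / (2 * Real.log |z.im|) := by
      rw [div_le_div_iff₀ (by positivity) (by positivity)]
      linarith
    have h4 : s.re - r ≤ z.re := by
      have := neg_abs_le (z.re - s.re)
      linarith
    have h5 : 1 - 1 / (4 * L) ≤ s.re - r := by
      have : 1 / (8 * L) + r = 1 / (4 * L) := by rw [hrdef]; ring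
      linarith
    linarith
  -- Cauchy's estimate
  have hdiff : DiffContOnCl ℂ riemannZeta (Metric.ball s r) := by
    refine DifferentiableOn.diffContOnCl ?_
    rw [closure_ball s hr0.ne']
    intro z hz
    have := (hdisc z hz).1
    refine (differentiableAt_riemannZeta_of_im_ne_zero ?_).differentiableWithinAt
    intro h0; rw [h0, abs_zero] at this; linarith
  have hbound : ∀ z ∈ Metric.sphere s r, ‖riemannZeta z‖ ≤ 42 * L := by
    intro z hz
    obtain ⟨hz3, hzlog, hzre⟩ := hdisc z (Metric.sphere_subset_closedBall hz)
    calc ‖riemannZeta z‖ ≤ 21 * Real.log |z.im| := norm_riemannZeta_le_log hz3 hzre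
      _ ≤ 21 * (2 * L) := by gcongr
      _ = 42 * L := by ring
  have hC := Complex.norm_deriv_le_of_forall_mem_sphere_norm_le hr0 hdiff hbound
  calc ‖deriv riemannZeta s‖ ≤ 42 * L / r := hC
    _ = 336 * L ^ 2 := by rw [hrdef]; field_simp; ring

/-! ## Titchmarsh §3.6: `1/ζ(s) = O(log⁷ t)` and the zero-free region `σ > 1 - A log⁻⁹ t` -/

/-- The Hadamard–de la Vallée Poussin–Mertens inequality for `ζ` (Titchmarsh (3.6.1) before taking
roots): `‖ζ(1+x)‖³ ‖ζ(1+x+iy)‖⁴ ‖ζ(1+x+2iy)‖ ≥ 1` for `x > 0` (Mathlib,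
`DirichletCharacter.norm_LFunction_product_ge_one` for the trivial character mod `1`).
[cite: Titchmarsh1986, §3.6 eq. (3.6.1)] -/
theorem one_le_norm_riemannZeta_three_four_one {x : ℝ} (hx : 0 < x) (y : ℝ) :
    1 ≤ ‖riemannZeta (1 + x)‖ ^ 3 * ‖riemannZeta (1 + x + I * y)‖ ^ 4 *
      ‖riemannZeta (1 + x + 2 * I * y)‖ := by
  have h := DirichletCharacter.norm_LFunction_product_ge_one (1 : DirichletCharacter ℂ 1) hx y
  rw [one_pow] at h
  simp only [DirichletCharacter.LFunction_modOne_eq, norm_mul, norm_pow] at h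
  exact h

/-- `‖ζ(1+x)‖ ≤ 3/x` for `0 < x ≤ 1` (from Titchmarsh (2.12.2), tree
`Literature.NumberTheory.LFunctions.norm_riemannZeta_le_of_re_pos`). [folklore] -/
theorem norm_riemannZeta_one_add_le {x : ℝ} (hx : 0 < x) (hx1 : x ≤ 1) :
    ‖riemannZeta (1 + x)‖ ≤ 3 / x := by
  have h := Literature.NumberTheory.LFunctions.norm_riemannZeta_le_of_re_pos (s := 1 + x) (by simp; linarith)
    (by intro h; have := congrArg Complex.re h; simp at this; linarith)
  have e1 : ‖(1 : ℂ) + x‖ = 1 + x := by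
    rw [show (1 : ℂ) + x = ((1 + x : ℝ) : ℂ) by push_cast; ring, Complex.norm_real,
      Real.norm_eq_abs, abs_of_pos (by linarith)]
  have e2 : ‖(1 : ℂ) + x - 1‖ = x := by
    rw [show (1 : ℂ) + x - 1 = ((x : ℝ) : ℂ) by ring, Complex.norm_real,
      Real.norm_eq_abs, abs_of_pos hx]
  have e3 : ((1 : ℂ) + x).re = 1 + x := by simp
  rw [e1, e2, e3, div_self (by linarith : (1 + x : ℝ) ≠ 0)] at h
  calc ‖riemannZeta (1 + x)‖ ≤ (1 + x) / x + 1 := h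
    _ = (1 + 2 * x) / x := by field_simp; ring
    _ ≤ 3 / x := by gcongr; linarith

/-- **Titchmarsh (3.6.1)**, explicit fourth-power form: for `|y| ≥ 4` and `0 < x ≤ 1`,
`‖ζ(1+x+iy)‖⁴ ≥ x³ / (1134 log|y|)` (`ζ(1+x) ≤ 3/x`, `ζ(1+x+2iy) ≤ 42 log|y|` by Thm. 3.5).
[cite: Titchmarsh1986, §3.6 eq. (3.6.1)] -/
theorem norm_riemannZeta_pow_four_ge {x y : ℝ} (hx : 0 < x) (hx1 : x ≤ 1) (hy : 4 ≤ |y|) :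
    x ^ 3 / (1134 * Real.log |y|) ≤ ‖riemannZeta (1 + x + I * y)‖ ^ 4 := by
  set L := Real.log |y| with hLdef
  have hL2 : Real.log 2 ≤ L := Real.log_le_log (by norm_num) (le_trans (by norm_num) hy)
  have hL : 1 < L :=
    MertensBound.one_lt_log_three.trans_le (Real.log_le_log (by norm_num) (le_trans (by norm_num) hy))
  have hL0 : 0 < L := zero_lt_one.trans hL
  have h341 := one_le_norm_riemannZeta_three_four_one hx y
  have hP := norm_riemannZeta_one_add_le hx hx1
  -- `‖ζ(1+x+2iy)‖ ≤ 42 L`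
  have hQ : ‖riemannZeta (1 + x + 2 * I * y)‖ ≤ 42 * L := by
    have him : ((1 : ℂ) + x + 2 * I * y).im = 2 * y := by simp
    have hre : ((1 : ℂ) + x + 2 * I * y).re = 1 + x := by simp
    have h2y : 3 ≤ |2 * y| := by rw [abs_mul, abs_two]; linarith
    have hlog2y : Real.log |2 * y| = Real.log 2 + L := by
      rw [abs_mul, abs_two, Real.log_mul (by norm_num) (by intro h; rw [h] at hy; norm_num at hy)]
    have hz := norm_riemannZeta_le_log (s := 1 + x + 2 * I * y) (by rwa [him]) (by
      rw [him, hre]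
      have : 0 < Real.log |2 * y| := by rw [hlog2y]; positivity
      have : 0 ≤ 1 / (2 * Real.log |2 * y|) := by positivity
      linarith)
    rw [him, hlog2y] at hz
    linarith
  set M := ‖riemannZeta (1 + x + I * y)‖ with hMdef
  have hM0 : 0 ≤ M := norm_nonneg _
  have hP0 : 0 ≤ ‖riemannZeta (1 + x)‖ := norm_nonneg _
  -- `1 ≤ (3/x)^3 M^4 (42 L)`
  have h1 : 1 ≤ (3 / x) ^ 3 * M ^ 4 * (42 * L) := by
    calc (1 : ℝ) ≤ ‖riemannZeta (1 + x)‖ ^ 3 * M ^ 4 * ‖riemannZeta (1 + x + 2 * I * y)‖ := h341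
      _ ≤ (3 / x) ^ 3 * M ^ 4 * (42 * L) := by gcongr
  rw [div_le_iff₀ (by positivity)]
  have h2 : (3 / x) ^ 3 * M ^ 4 * (42 * L) = (M ^ 4 * (1134 * L)) / x ^ 3 := by
    field_simp; ring
  rw [h2, le_div_iff₀ (by positivity)] at h1
  linarith

/-- `u ↦ ζ(u + iy)` along a horizontal line: derivative `ζ'(u + iy)` (`y ≠ 0`). [folklore] -/
theorem hasDerivAt_riemannZeta_horizontal {y : ℝ} (hy : y ≠ 0) (u : ℝ) :
    HasDerivAt (fun u : ℝ ↦ riemannZeta (u + I * y)) (deriv riemannZeta (u + I * y)) u := by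
  have h1 : HasDerivAt riemannZeta (deriv riemannZeta ((u : ℂ) + I * y)) ((u : ℂ) + I * y) :=
    (differentiableAt_riemannZeta_of_im_ne_zero (by simpa using hy)).hasDerivAt
  have h2 := HasDerivAt.comp_add_const (u : ℂ) (I * y) h1
  exact h2.comp_ofReal

/-- **Titchmarsh (3.6.2)**: `ζ(b+iy) - ζ(a+iy) = ∫_a^b ζ'(u+iy) du = O((b-a) log² y)`; explicitly,
for `|y| ≥ 4` and `1 - 1/(8 log|y|) ≤ a ≤ b`, `‖ζ(b+iy) - ζ(a+iy)‖ ≤ 336 (log|y|)² (b - a)`.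
[cite: Titchmarsh1986, §3.6 eq. (3.6.2)] -/
theorem norm_riemannZeta_sub_horizontal_le {a b y : ℝ} (hy : 4 ≤ |y|)
    (ha : 1 - 1 / (8 * Real.log |y|) ≤ a) (hab : a ≤ b) :
    ‖riemannZeta (b + I * y) - riemannZeta (a + I * y)‖ ≤ 336 * Real.log |y| ^ 2 * (b - a) := by
  have hy0 : y ≠ 0 := by intro h; rw [h] at hy; norm_num at hy
  have key := norm_image_sub_le_of_norm_deriv_le_segment'
    (f := fun u : ℝ ↦ riemannZeta (u + I * y))
    (f' := fun u : ℝ ↦ deriv riemannZeta (u + I * y)) (a := a) (b := b)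
    (C := 336 * Real.log |y| ^ 2) (fun u _ ↦ (hasDerivAt_riemannZeta_horizontal hy0 u).hasDerivWithinAt)
    (fun u hu ↦ by
      have him : ((u : ℂ) + I * y).im = y := by simp
      have hre : ((u : ℂ) + I * y).re = u := by simp
      have h := norm_deriv_riemannZeta_le_log_sq (s := u + I * y) (by rw [him]; exact hy)
        (by rw [him, hre]; linarith [hu.1])
      rw [him] at h
      exact h) b ⟨hab, le_rfl⟩
  exact key

/-- **Titchmarsh (3.6.3)–(3.6.5)** (`1/ζ(s) = O(log⁷ t)` for `σ ≥ 1 - A log⁻⁹ t`; in particular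
`ζ(s) ≠ 0` there): with the absolute constant `K = 1134 · 16 · 336⁴`, for `|t| ≥ 4` and
`1 - 1/(2K log⁹|t|) ≤ σ ≤ 2` one has `‖ζ(σ+it)‖ ≥ 168/(K log⁷|t|)`. Proof exactly as in
Titchmarsh: (3.6.1) gives `‖ζ(1+x+it)‖ ≥ 2δ` for `x = 1/(K log⁹|t|)`, `δ = 336 x log²|t|`, and
(3.6.2) moves horizontally by at most `3x/2` at cost `≤ 3δ/2`.
[cite: Titchmarsh1986, §3.6 eqs. (3.6.3)–(3.6.5)] -/
theorem norm_riemannZeta_ge_inv_log_pow_seven {s : ℂ} (ht : 4 ≤ |s.im|)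
    (hσ : 1 - 1 / (2 * (1134 * 16 * 336 ^ 4) * Real.log |s.im| ^ 9) ≤ s.re) (hσ2 : s.re ≤ 2) :
    168 / ((1134 * 16 * 336 ^ 4) * Real.log |s.im| ^ 7) ≤ ‖riemannZeta s‖ := by
  set t := s.im with htdef
  set σ := s.re with hσdef
  set L := Real.log |t| with hLdef
  set K : ℝ := 1134 * 16 * 336 ^ 4 with hKdef
  have hK1 : 1 ≤ K := by rw [hKdef]; norm_num
  have hK0 : 0 < K := by positivity
  have hL : 1 < L :=
    MertensBound.one_lt_log_three.trans_le (Real.log_le_log (by norm_num) (le_trans (by norm_num) ht))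
  have hL0 : 0 < L := zero_lt_one.trans hL
  have hL1 : 1 ≤ L := hL.le
  have ht0 : t ≠ 0 := by intro h; rw [h] at ht; norm_num at ht
  set x : ℝ := 1 / (K * L ^ 9) with hxdef
  have hx0 : 0 < x := by positivity
  have hx1 : x ≤ 1 := by
    rw [hxdef, div_le_one (by positivity)]
    calc (1 : ℝ) = 1 * 1 ^ 9 := by norm_num
      _ ≤ K * L ^ 9 := by gcongr
  set δ : ℝ := 336 * L ^ 2 * x with hδdef
  have hδ0 : 0 < δ := by positivity
  -- the target constant is `δ/2`
  have hgoal : 168 / (K * L ^ 7) = δ / 2 := by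
    rw [hδdef, hxdef]; field_simp; ring
  -- `x/2 ≤ 1/(8L)`: the region of (3.5.5) contains `σ ≥ 1 - x/2`
  have hx8 : x / 2 ≤ 1 / (8 * L) := by
    rw [hxdef, div_div, div_le_div_iff₀ (by positivity) (by positivity), one_mul, one_mul]
    calc 8 * L = 8 * L * 1 ^ 8 := by ring
      _ ≤ K * L * L ^ 8 := by gcongr; rw [hKdef]; norm_num
      _ = K * L ^ 9 := by ring
      _ ≤ K * L ^ 9 * 2 := by linarith [show 0 < K * L ^ 9 by positivity]
  have hσx : 1 - x / 2 ≤ σ := by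
    have : 1 / (2 * K * L ^ 9) = x / 2 := by rw [hxdef]; field_simp
    rw [← this]; exact hσ
  -- Step 1: `‖ζ(1 + x' + it)‖ ≥ 2δ` for `x ≤ x' ≤ 1`
  have hstep1 : ∀ x' : ℝ, x ≤ x' → x' ≤ 1 → 2 * δ ≤ ‖riemannZeta (1 + x' + I * t)‖ := by
    intro x' hxx' hx'1
    have hx'0 : 0 < x' := hx0.trans_le hxx'
    have h4 := norm_riemannZeta_pow_four_ge hx'0 hx'1 ht
    rw [← hLdef] at h4
    refine le_of_pow_le_pow_left₀ (by norm_num : (4 : ℕ) ≠ 0) (norm_nonneg _) ?_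
    have hA : (2 * δ) ^ 4 ≤ x ^ 3 / (1134 * L) := by
      rw [hδdef, le_div_iff₀ (by positivity)]
      have : (2 * (336 * L ^ 2 * x)) ^ 4 * (1134 * L) = x ^ 3 * (x * (K * L ^ 9)) := by
        rw [hKdef]; ring
      rw [this, hxdef, div_mul_cancel₀ _ (by positivity), mul_one]
    have hB : x ^ 3 / (1134 * L) ≤ x' ^ 3 / (1134 * L) := by gcongr
    exact hA.trans (hB.trans h4)
  -- Step 2: the two cases
  rw [hgoal]
  have hs : s = σ + I * t := by
    apply Complex.ext <;> simp [← hσdef, ← htdef]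
  by_cases hcase : 1 + x ≤ σ
  · -- `σ = 1 + x'` with `x ≤ x' ≤ 1`
    have h := hstep1 (σ - 1) (by linarith) (by linarith)
    rw [show (1 : ℂ) + ((σ - 1 : ℝ) : ℂ) = (σ : ℂ) by push_cast; ring] at h
    rw [hs]
    linarith
  · push Not at hcase
    have hmv := norm_riemannZeta_sub_horizontal_le (a := σ) (b := 1 + x) ht
      (by linarith) hcase.le
    have h2δ := hstep1 x le_rfl hx1
    have hdiff : 336 * L ^ 2 * (1 + x - σ) ≤ 3 / 2 * δ := by
      rw [hδdef]
      have : 1 + x - σ ≤ 3 / 2 * x := by linarith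
      calc 336 * L ^ 2 * (1 + x - σ) ≤ 336 * L ^ 2 * (3 / 2 * x) := by gcongr
        _ = 3 / 2 * (336 * L ^ 2 * x) := by ring
    rw [hs]
    have htri : ‖riemannZeta (1 + x + I * t)‖ ≤
        ‖riemannZeta (1 + x + I * t) - riemannZeta (σ + I * t)‖ + ‖riemannZeta (σ + I * t)‖ :=
      norm_le_norm_sub_add _ _
    push_cast at hmv htri h2δ ⊢
    linarith

/-! ## The logarithmic derivative of `ζ₁(s) = (s-1)ζ(s)` (Titchmarsh (3.6.6)) -/

/-- The absolute constant `K = 1134 · 16 · 336⁴` of `norm_riemannZeta_ge_inv_log_pow_seven` is `≥ 1`.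
[folklore] -/
theorem one_le_K : (1 : ℝ) ≤ 1134 * 16 * 336 ^ 4 := by norm_num

/-- `ζ₁'(s) = ζ(s) + (s-1) ζ'(s)` for `s ≠ 1`. [folklore] -/
theorem deriv_riemannZeta₁_eq {s : ℂ} (hs : s ≠ 1) :
    deriv riemannZeta₁ s = riemannZeta s + (s - 1) * deriv riemannZeta s := by
  have hev : riemannZeta₁ =ᶠ[𝓝 s] fun z ↦ (z - 1) * riemannZeta z := by
    filter_upwards [isOpen_ne.mem_nhds hs] with z hz
    exact LFunctions.riemannZeta₁_eq_mul hz
  rw [hev.deriv_eq]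
  have h1 : HasDerivAt (fun z : ℂ ↦ z - 1) 1 s := (hasDerivAt_id s).sub_const 1
  have h2 : HasDerivAt riemannZeta (deriv riemannZeta s) s :=
    (differentiableAt_riemannZeta hs).hasDerivAt
  have h3 : HasDerivAt (fun z : ℂ ↦ (z - 1) * riemannZeta z)
      (1 * riemannZeta s + (s - 1) * deriv riemannZeta s) s := h1.mul h2
  rw [h3.deriv]
  ring

/-- `ζ₁(s) ≠ 0` on the closed half-plane `Re s ≥ 1` (`ζ₁(1) = 1`, and `ζ(s) ≠ 0` for `Re s ≥ 1`,
Mathlib `riemannZeta_ne_zero_of_one_le_re`). [folklore] -/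
theorem riemannZeta₁_ne_zero_of_one_le_re {s : ℂ} (hs : 1 ≤ s.re) : riemannZeta₁ s ≠ 0 := by
  rcases eq_or_ne s 1 with rfl | hs1
  · rw [riemannZeta₁_one]; exact one_ne_zero
  · rw [LFunctions.riemannZeta₁_eq_mul hs1]
    exact mul_ne_zero (sub_ne_zero.mpr hs1) (riemannZeta_ne_zero_of_one_le_re hs)

/-- **Zero-free region** (Titchmarsh (3.6.4)–(3.6.5)): `ζ₁(s) ≠ 0` (equivalently `ζ(s) ≠ 0`) for
`|t| ≥ 4`, `1 - 1/(2K log⁹|t|) ≤ σ ≤ 2`. [cite: Titchmarsh1986, §3.6 eq. (3.6.4)–(3.6.5)] -/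
theorem riemannZeta₁_ne_zero_of_re_ge {s : ℂ} (ht : 4 ≤ |s.im|)
    (hσ : 1 - 1 / (2 * (1134 * 16 * 336 ^ 4) * Real.log |s.im| ^ 9) ≤ s.re) (hσ2 : s.re ≤ 2) :
    riemannZeta₁ s ≠ 0 := by
  have hs1 : s ≠ 1 := by
    intro h; rw [h] at ht; norm_num at ht
  have hL : 1 < Real.log |s.im| :=
    MertensBound.one_lt_log_three.trans_le (Real.log_le_log (by norm_num) (le_trans (by norm_num) ht))
  have hpos : (0 : ℝ) < 168 / ((1134 * 16 * 336 ^ 4) * Real.log |s.im| ^ 7) := by positivity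
  have h := norm_riemannZeta_ge_inv_log_pow_seven ht hσ hσ2
  rw [LFunctions.riemannZeta₁_eq_mul hs1]
  refine mul_ne_zero (sub_ne_zero.mpr hs1) fun h0 ↦ ?_
  rw [h0, norm_zero] at h
  linarith

/-- **Titchmarsh (3.6.6)** for the pole-free logarithmic derivative:
`ζ₁'/ζ₁(s) = 1/(s-1) + ζ'/ζ(s) = O(log⁹ t)`; explicitly, for `|t| ≥ 4` and
`1 - 1/(2K log⁹|t|) ≤ σ ≤ 2` (`K = 1134·16·336⁴`), `‖ζ₁'(s)/ζ₁(s)‖ ≤ 3K log⁹|t|`.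
[cite: Titchmarsh1986, §3.6 eq. (3.6.6)] -/
theorem norm_logDeriv_riemannZeta₁_le {s : ℂ} (ht : 4 ≤ |s.im|)
    (hσ : 1 - 1 / (2 * (1134 * 16 * 336 ^ 4) * Real.log |s.im| ^ 9) ≤ s.re) (hσ2 : s.re ≤ 2) :
    ‖deriv riemannZeta₁ s / riemannZeta₁ s‖ ≤
      3 * (1134 * 16 * 336 ^ 4) * Real.log |s.im| ^ 9 := by
  set t := s.im with htdef
  set L := Real.log |t| with hLdef
  set K : ℝ := 1134 * 16 * 336 ^ 4 with hKdef
  have hK1 : 1 ≤ K := one_le_K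
  have hL : 1 < L :=
    MertensBound.one_lt_log_three.trans_le (Real.log_le_log (by norm_num) (le_trans (by norm_num) ht))
  have hL1 : 1 ≤ L := hL.le
  have hs1 : s ≠ 1 := by
    intro h; rw [htdef, h] at ht; norm_num at ht
  have hζ : riemannZeta s ≠ 0 := by
    have := riemannZeta₁_ne_zero_of_re_ge ht hσ hσ2
    rw [LFunctions.riemannZeta₁_eq_mul hs1] at this
    exact (mul_ne_zero_iff.mp this).2
  have hlow := norm_riemannZeta_ge_inv_log_pow_seven ht hσ hσ2
  rw [← htdef, ← hLdef, ← hKdef] at hlow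
  -- `ζ₁'/ζ₁ = 1/(s-1) + ζ'/ζ`
  have heq : deriv riemannZeta₁ s / riemannZeta₁ s =
      1 / (s - 1) + deriv riemannZeta s / riemannZeta s := by
    rw [deriv_riemannZeta₁_eq hs1, LFunctions.riemannZeta₁_eq_mul hs1]
    field_simp [sub_ne_zero.mpr hs1, hζ]
  rw [heq]
  -- `‖1/(s-1)‖ ≤ 1/|t| ≤ 1`
  have h1 : ‖1 / (s - 1)‖ ≤ 1 := by
    rw [norm_div, norm_one]
    have : |t| ≤ ‖s - 1‖ := by
      have := abs_im_le_norm (s - 1); simpa [← htdef] using this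
    rw [div_le_one (lt_of_lt_of_le (by linarith) this)]
    linarith
  -- `‖ζ'/ζ‖ ≤ 336 L² · K L⁷/168 = 2 K L⁹`
  have hσ' : 1 - 1 / (8 * L) ≤ s.re := by
    refine le_trans ?_ hσ
    have hKL : 8 * L ≤ 2 * K * L ^ 9 := by
      calc 8 * L = 8 * L * 1 ^ 8 := by ring
        _ ≤ 2 * K * L * L ^ 8 := by gcongr; linarith
        _ = 2 * K * L ^ 9 := by ring
    have : 1 / (2 * K * L ^ 9) ≤ 1 / (8 * L) :=
      one_div_le_one_div_of_le (by positivity) hKL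
    linarith
  have h2 : ‖deriv riemannZeta s / riemannZeta s‖ ≤ 2 * K * L ^ 9 := by
    rw [norm_div, div_le_iff₀ (norm_pos_iff.mpr hζ)]
    have hd := norm_deriv_riemannZeta_le_log_sq ht hσ'
    rw [← htdef, ← hLdef] at hd
    calc ‖deriv riemannZeta s‖ ≤ 336 * L ^ 2 := hd
      _ = 2 * K * L ^ 9 * (168 / (K * L ^ 7)) := by field_simp; ring
      _ ≤ 2 * K * L ^ 9 * ‖riemannZeta s‖ := by gcongr
  calc ‖1 / (s - 1) + deriv riemannZeta s / riemannZeta s‖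
      ≤ ‖1 / (s - 1)‖ + ‖deriv riemannZeta s / riemannZeta s‖ := norm_add_le _ _
    _ ≤ 1 + 2 * K * L ^ 9 := add_le_add h1 h2
    _ ≤ 3 * K * L ^ 9 := by nlinarith [one_le_pow₀ (n := 9) hL1]

end Literature.NumberTheory.LFunctions.ZetaOneLine
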